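import Literature.Analysis.FluidPDE.NSLerayHopf
import Literature.Analysis.FluidPDE.NSHopfGalerkin
import Literature.Analysis.FluidPDE.LerayHopfTimeSlice
import Literature.Analysis.FunctionSpaces.MollificationLp
import HarnessLib

/-!
# Navier–Stokes on `ℝ³`: Leray's existence theorem via the Leray regularisation
  (proof architecture of `NS.leray_existence_R3`, named sub-results, assembly)

Trunk: FluidKinetic. This file decomposes the named fact `Literature.Analysis.FluidPDE.leray_existence_R3`
(`Literature/Analysis/FluidPDE/NSLerayHopf`: for `ν > 0` and a weakly divergence-free datum
`u₀ ∈ L²(ℝ³)` there is a global Leray–Hopf weak solution of the unforced Navier–Stokes system)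
along the printed proof — **Leray's own** (Leray 1934, Ch. V, §§26–31), in the modern expositions of
Ożański–Pooley 2018, §6.4 (Thm. 6.33, Lemma 6.34, Def. 6.35, Cor. 6.36, Thm. 6.37) and
Robinson–Rodrigo–Sadowski 2016, §14.5 (Thm. 14.1, Prop. 14.3, Thm. 14.4) — into two named
sub-results whose interface is an explicit **Leray regularised scheme** predicate, and proves the
assembly. It is the `ℝ³` companion of `FluidPDE/NSHopfGalerkin` (Hopf's theorem on `𝕋³` via the
Fourier–Galerkin scheme).

## The printed proof

1. **The regularised problem** (Leray 1934, §26, system (5.1); OP 2018, (6.77), Thm. 6.33; RRS 2016,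
   (14.16), Thm. 14.1 on `𝕋³`). For `ε > 0` replace the advecting velocity by its mollification:
   `∂ₜu − νΔu + ((J_ε u)·∇)u + ∇p = 0`, `div u = 0`, `u(0) = J_ε u₀`. Everything proved for regular
   solutions of the Navier–Stokes equations in Leray's Ch. III applies, and in addition
   `‖J_ε u‖_∞ ≤ A₀ ε^{-3/2} ‖u‖₂ ≤ A₀ ε^{-3/2} ‖u₀‖₂` turns the a priori inequality for `‖u(t)‖_∞`
   into a *linear* Volterra inequality, so the unique regular solution `u_ε` exists for all `t ≥ 0`,
   is smooth for `t > 0`, continuous into `L²` at `t = 0`, and satisfies the **energy equality**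
   `½‖u_ε(t)‖² + ν∫ₛᵗ‖∇u_ε‖² = ½‖u_ε(s)‖²`.
2. **Separation of energy** (Leray 1934, §27, (5.2)–(5.7): "Ces résultats devront être indépendants
   de `ε`"; OP 2018, Lemma 6.34; RRS 2016, Prop. 14.3). For `0 < R₁ < R₂` and `t ≥ 0`,
   `∫_{|x|>R₂} |u_ε(t)|² ≤ ∫_{|x|>R₁} |u_ε(0)|² + C̄(t)/(R₂ − R₁)` with `C̄` independent of `ε`
   (pair the equation with `ϱ u_ε` for a radial ramp `ϱ`; the pressure is controlled by
   `‖p‖₂ ≤ C‖u‖₄²` and `‖u‖₄⁴ ≤ C‖∇u‖₂³‖u‖₂`).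
3. **Passage to the limit `ε → 0`** (Leray 1934, §§28–31; OP 2018, Thm. 6.37, Steps 1–4, and
   Cor. 6.36; RRS 2016, Thm. 14.4). Diagonal extraction of a sequence `εₙ → 0` along which
   `‖u_εₙ(t)‖₂ → W(t)` (Helly) and the space–time means over rational boxes converge; slice-wise
   weak `L²` limits `u(t)` for every `t ≥ 0`; Fatou makes `S = {t : ‖∇u_εₙ(t)‖₂ → ∞}` a null set;
   for `t ∉ S` the Rellich compactness on the ball `B(R₂)` together with step 2 upgrades weak to
   strong convergence `u_εₙ(t) → u(t)` in `L²(ℝ³)`; the weak formulation passes to the limit, the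
   energy inequalities (from `0` and from every `s ∉ S`) follow by lower semicontinuity, weak `L²`
   continuity from the weak formulation and the `L²` bound, and strong attainment of the datum from
   the energy inequality (`½‖u(t)‖² ≤ ½‖u₀‖²` plus `u(t) ⇀ u₀`).

## Contents

* `NS.mollify φ v` — the Friedrichs mollification `J_φ v = φ.normed ⋆ v` of a field by a
  normalised Mathlib bump kernel (reducible abbreviation of Mathlib's convolution, the spelling of
  `Literature/Analysis/FunctionSpaces/Mollification`).
* `NS.IsLerayRegularisedScheme ν u₀ φ U` — a sequence of solutions `U n` of the Leray-regularised
  problems with kernels `φ n` (`rOut (φ n) → 0`) and data `U n 0 = J_{φ n} u₀`, recorded through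
  exactly the properties that the passage to the limit consumes: joint `C¹` regularity on
  `(0, ∞) × E`, continuity into `L²` on `[0, ∞)`, incompressibility, the regularised equations in
  weak (pressure-free, divergence-free-tested, time-sliced) form, the energy equality with finite
  dissipation, and the separation-of-energy estimate uniform in `n` (steps 1–2 above).
* `NS.leray_regularised_scheme_exists` — **named fact** (Leray 1934, §§26–27; OP 2018, Thm. 6.33 and
  Lemma 6.34; RRS 2016, Thm. 14.1 / Prop. 14.3): every datum as in `leray_existence_R3` admits a
  Leray regularised scheme.
* `NS.leray_regularised_limit` — **named fact** (Leray 1934, §§28–31; OP 2018, Thm. 6.37 and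
  Cor. 6.36; RRS 2016, Thm. 14.4): every Leray regularised scheme yields a global Leray–Hopf weak
  solution with datum `u₀`.
* `NS.leray_existence_R3_of_regularised` — the **assembly** (real proof):
  `leray_regularised_scheme_exists → leray_regularised_limit → leray_existence_R3`.
* Real proofs serving the limit half: the scheme API (`IsLerayRegularisedScheme.memLp_initial`,
  `.eLpNorm_initial_le`, `.tendsto_initial`, `.kineticEnergy_initial_le`, `.kineticEnergy_le`,
  `.kineticEnergy_le_datum`, `.eEnergy_le`, `.eLpNorm_le`, `.eLpNorm_mollify_slice_le`,
  `.dissipation_le` — the uniform `L²` bound OP (6.88)/(6.92); `.contDiff_slice`,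
  `.hasWeakGradient_slice`, `.isWeaklyDivFree`; the two derived forms of the equations
  `.spaceTime_identity` (the `Fluid.IsWeakNSSolutionOn` shape) and `.slice_identity`
  (time-independent tests, OP (6.96))), and the `E`-side twins of the
  `NSHopfGalerkin` lemmas `NS.fluid_strong_initial_of_energy_ineq` (RRS 2016, Cor. 4.7: the energy
  inequality from `0` plus `u(t) ⇀ u₀` force `u(t) → u₀` in `L²`) and
  `NS.fluid_isLerayHopfOn_of_clauses` (the `strong_initial` clause of `Fluid.IsLerayHopfOn` is
  automatic for any candidate limit).

## Why this interface

The two halves of the printed proof communicate only through the listed properties of the family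
`(u_ε)`: OP 2018, proof of Thm. 6.37, uses of `u_ε` exactly (6.88) (energy equality and
`‖J_ε u₀‖ ≤ ‖u₀‖`), (6.89) (the regularised equations tested against divergence-free fields),
(6.91) (`J_ε u₀ → u₀`), (6.92) (`‖J_ε v‖ ≤ ‖v‖`), the smoothness of `u_ε` for `t > 0` (so that
`∇u_ε(t)` is a classical gradient, (6.101)–(6.103)) and the separation of energy (6.104); the
pressure never enters the limit passage, which is why the scheme is pressure-free while the tail
estimate — whose proof does use the pressure — is a field. The datum of the tail estimate is the
scheme's own `U n 0 = J_{φ n} u₀` (OP Lemma 6.34 is stated for the datum of `u_ε`); its tails are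
controlled uniformly through `U n 0 → u₀` in `L²` (`IsLerayRegularisedScheme.tendsto_initial`).

## Citation note on `NS.leray_existence_R3`

The docstring of the decomposed fact locates Leray's theorem at "§III, §§31–34, théorème
d'existence of §34" and names RRS 2016, Thm. 4.10 as its modern form. The existence theorem is the
"Théorème d'existence" closing §31 (Ch. V), Acta Math. 63, p. 241 ("Supposons donné à l'instant
initial un état initial `U_i(x)`, tel que les fonctions `U_i(x)` soient de carrés sommables … et que
le vecteur … possède une quasi-divergence nulle. Il correspond à cet état initial au moins une
solution turbulente, qui est définie pour toutes les valeurs du temps postérieures à l'instant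
initial"); §34 is the structure theorem. RRS 2016, Thm. 4.10 (expanding domains, after Heywood 1988)
produces weak solutions *without* the strong energy inequality (RRS, p. 101: "not known to satisfy
the strong energy inequality"), whereas `Fluid.IsLerayHopfOn` demands the energy inequality from
a.e. `s`; the modern statements matching the fact are RRS 2016, Thm. 14.4 and OP 2018, Thm. 6.37 with
Cor. 6.36 (weak `L²` continuity, `u(t) → u(s)` as `t → s⁺` for `s ∉ S`). The fact itself is stated
faithfully (it is Leray's theorem); only the locator is imprecise.

## Mathlib search

Mathlib (this pin) has convolution with normalised bump kernels (`ContDiffBump.normed`,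
`MeasureTheory.convolution`), used here through the tree's `Mollification`/`MollificationLp`
(`Literature.Analysis.FunctionSpaces.eLpNorm_normed_convolution_le`, `Literature.Analysis.FunctionSpaces.memLp_normed_convolution`,
`Literature.Analysis.FunctionSpaces.tendsto_eLpNorm_normed_convolution_sub_self`); no Navier–Stokes, Leray regularisation, Oseen
kernel or Aubin–Lions material (searched `Leray`, `Oseen`, `NavierStokes`, `mollif`: only
`Literature/`). For the halves to come the tree already holds: Rellich–Kondrachov on bounded
Lipschitz domains (`Literature.rellich_kondrachov_domain'_holds`), the Gagliardo–Nirenberg–Sobolev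
inequality (`FunctionSpaces/GagliardoNirenbergSobolev`, `FluidPDE/SobolevWholeSpace`), heat/Duhamel
calculus (`FluidPDE/HeatDuhamel*`, `FluidPDE/MildSolution*`), whole-space integration by parts
(`FluidPDE/WholeSpaceIBP`), the energy equality of classical solutions
(`FluidPDE/LerayHopfProofs`) and the time-sliced weak formulation with the du Bois-Reymond lemma
(`FluidPDE/LerayHopfTimeSlice`).

## References

* J. Leray, *Sur le mouvement d'un liquide visqueux emplissant l'espace*, Acta Math. 63 (1934),
  193–248: Ch. V, §26 (pp. 231–232, global regular solutions of the regularised system (5.1)),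
  §27 (pp. 232–235, (5.2)–(5.7), répartition de l'énergie), §§28–30 (passage to the limit),
  §31 (pp. 240–241, definition of solutions turbulentes and the Théorème d'existence).
* W. S. Ożański, B. C. Pooley, *Leray's fundamental work on the Navier–Stokes equations: a modern
  review*, in: Partial Differential Equations in Fluid Mechanics, LMS Lecture Note Ser. 452 (CUP
  2018), §6.4: Def. 6.32, Thm. 6.33, Lemma 6.34, Def. 6.35, Cor. 6.36, Thm. 6.37 (Steps 1–4),
  (6.77)–(6.104).
* J. C. Robinson, J. L. Rodrigo, W. Sadowski, *The three-dimensional Navier–Stokes equations*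
  (CUP 2016), Thm. 4.10 and p. 101 (expanding domains, no strong energy inequality), §14.5:
  (14.16)–(14.19), Thm. 14.1, Prop. 14.3, Thm. 14.4; Cor. 4.7 and Lemma A.20 (strong attainment of
  the datum).
* E. Hopf, *Über die Anfangswertaufgabe für die hydrodynamischen Grundgleichungen*, Math. Nachr. 4
  (1951), §4 (`u(t) → u₀` strongly).

*Imports (module hygiene, 2026-08-16, refactor item `defn-NSLerayHopfOpenFacts`):* the hub
`Literature.Analysis.FluidPDE.NSLerayHopf` is imported explicitly (this file uses its
declarations), since `NSHopfGalerkin` — through which it used to arrive — no longer imports it.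
-/

noncomputable section

open MeasureTheory TopologicalSpace Set Function Filter Topology ContinuousLinearMap
open scoped InnerProductSpace RealInnerProductSpace ENNReal NNReal Laplacian Convolution

namespace Literature.Analysis.FluidPDE

/-! ### Mollification and the scheme predicate (general dimension) -/

section Scheme

variable {E : Type*} [NormedAddCommGroup E] [InnerProductSpace ℝ E] [FiniteDimensional ℝ E]
  [MeasurableSpace E] [BorelSpace E]
variable {F : Type*} [NormedAddCommGroup F] [NormedSpace ℝ F]

/-- The **Friedrichs mollification** `J_φ v = φ.normed ⋆ v`, `(J_φ v)(x) = ∫ φ.normed(y) v(x - y) dy`,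
of a field `v : E → F` by the normalised (unit-mass, nonnegative, radial) Mathlib bump kernel
`φ.normed volume` supported in the ball of radius `φ.rOut` — Leray's `\overline{U}(x)` (Leray 1934,
§8, p. 206, with the length `ε = rOut φ`), the `J_ε` of Ożański–Pooley 2018, (6.77), and the `ψ_ε *`
of Robinson–Rodrigo–Sadowski 2016, (14.16). A reducible abbreviation of Mathlib's convolution in the
spelling of `Literature/Analysis/FunctionSpaces/Mollification`, so that the tree's lemmas
(`eLpNorm_normed_convolution_le`, `tendsto_eLpNorm_normed_convolution_sub_self`, …) apply verbatim.
[cite: OzanskiPooley2018, (6.77)] -/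
abbrev mollify (φ : ContDiffBump (0 : E)) (v : E → F) : E → F :=
  φ.normed volume ⋆[lsmul ℝ ℝ, volume] v

/-- Unfolding `mollify`. [folklore] -/
theorem mollify_def (φ : ContDiffBump (0 : E)) (v : E → F) :
    mollify φ v = φ.normed volume ⋆[lsmul ℝ ℝ, volume] v :=
  rfl

/-- **A Leray regularised scheme** for the unforced Navier–Stokes system on `E` with viscosity
`ν` and datum `u₀`: a sequence `U n : ℝ → E → E` of global solutions of the Leray-regularised
problems `∂ₜu − νΔu + ((J_{φ n} u)·∇)u + ∇p = 0`, `div u = 0`, `u(0) = J_{φ n} u₀` with mollifier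
radii `rOut (φ n) → 0`, recorded through exactly the properties that the passage to the limit
consumes (Leray 1934, §§26–27; Ożański–Pooley 2018, Def. 6.32, Thm. 6.33, Lemma 6.34 and
(6.88)–(6.92); Robinson–Rodrigo–Sadowski 2016, (14.16)–(14.18), Prop. 14.3):
* `U n` is jointly `C¹` on `(0, ∞) × E` (Leray: régulière) and continuous into `L²` on `[0, ∞)`
  (`u_ε ∈ C([0,∞); L²)`), with divergence-free slices for `t > 0`;
* the **regularised equations** in weak form (OP (6.89) between two times): for every smooth
  compactly supported space–time field `ψ` with divergence-free slices and `0 ≤ s ≤ t`,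
  `⟪U n t, ψ t⟫ − ⟪U n s, ψ s⟫ = ∫ₛᵗ∫ (⟪U n, ∂ₜψ⟫ + ⟪U n, ((J_{φ n} U n)·∇)ψ⟫ + ν⟪U n, Δψ⟫)`
  (the pressure drops out against divergence-free tests; the unforced `Fluid.IsWeakNSSolutionOn`
  identity with the advecting velocity mollified is the case `s = 0`, `t = T`);
* the **energy equality** `½‖U n t‖² + ν∫ₛᵗ‖∇U n‖₂² = ½‖U n s‖²` for `0 ≤ s ≤ t`, the dissipation
  (classical gradient, Frobenius norm) being finite on every `(0, T)` (OP (6.80); RRS (14.17));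
* the **separation of energy**, uniformly in `n`: for some `C̄ : ℝ → ℝ` and all `n`,
  `0 < R₁ < R₂`, `t ≥ 0`: `∫_{‖x‖>R₂} ‖U n t‖² ≤ ∫_{‖x‖>R₁} ‖U n 0‖² + C̄(t)/(R₂ − R₁)`
  (Leray (5.7); OP Lemma 6.34; RRS Prop. 14.3);
* the datum `U n 0 = J_{φ n} u₀` (OP (6.91); RRS (14.16)).
[cite: OzanskiPooley2018, Def. 6.32, Thm. 6.33, Lemma 6.34, (6.88)–(6.92)] [cite: Leray1934, §§26–27 (5.1)–(5.7)] -/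
structure IsLerayRegularisedScheme (ν : ℝ) (u₀ : E → E) (φ : ℕ → ContDiffBump (0 : E))
    (U : ℕ → ℝ → E → E) : Prop where
  /-- The mollification lengths tend to zero: `rOut (φ n) → 0` (`εₙ → 0`). -/
  tendsto_rOut : Tendsto (fun n => (φ n).rOut) atTop (𝓝 0)
  /-- `U n` is (at least) jointly `C¹` on `(0, ∞) × E` — Leray's regular solutions have `u`,
  `∂ₜu`, `∇u`, `∇²u` (and `p`, `∇p`) continuous (Leray 1934, §11, p. 217, and §26: the regularised
  solution is régulière for all `t > 0`); Ożański–Pooley 2018, Thm. 6.33 with Cor. 6.16 even give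
  smoothness. Joint `C¹` is what the limit passage consumes (classical = weak spatial gradient of
  the slices, joint measurability of `∇U n`). -/
  contDiffOn : ∀ n, ContDiffOn ℝ 1 (uncurry (U n)) (Ioi 0 ×ˢ univ)
  /-- `U n ∈ C([0, ∞); L²(E))`: every slice `U n t`, `t ≥ 0`, is in `L²` and `t ↦ U n t` is
  `L²`-continuous on `[0, ∞)` (OP 2018, Def. 6.32). -/
  continuousInL2 : ∀ n, FluidPDE.ContinuousInLpOn (Ici 0) 2 (U n)
  /-- Incompressibility: `div (U n t) = 0` pointwise for `t > 0` (Leray 1934, (5.1)). -/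
  divFree : ∀ n t, 0 < t → VectorCalculus.IsDivFree (U n t)
  /-- **The regularised equations in weak form** (OP 2018, (6.89), written between two times;
  Leray 1934, (5.1) paired with a test field as in (5.15)): for every smooth compactly supported
  space–time field `ψ` with divergence-free slices and all `0 ≤ s ≤ t`,
  `⟪U n t, ψ t⟫ − ⟪U n s, ψ s⟫ = ∫ₛᵗ ∫ (⟪U n, ∂ₜψ⟫ + ⟪U n, ((J_{φ n} U n)·∇)ψ⟫ + ν ⟪U n, Δψ⟫)` —
  the momentum equation paired with `ψ` and integrated by parts, the pressure dropping out against
  divergence-free fields and `∫⟪(v·∇)u, ψ⟫ = −∫⟪u, (v·∇)ψ⟫` for the divergence-free advecting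
  velocity `v = J_{φ n} U n`. The space–time form of `Fluid.IsWeakNSSolutionOn` (tests supported in
  `t < T`, datum term at `t = 0`) is the case `s = 0`, `t = T`
  (`IsLerayRegularisedScheme.spaceTime_identity`). -/
  regularised : ∀ n (ψ : ℝ → E → E), FluidPDE.IsSpaceTimeTestOn (⊤ : Opens (ℝ × E)) ψ →
    (∀ τ, VectorCalculus.IsDivFree (ψ τ)) → ∀ s t, 0 ≤ s → s ≤ t →
      (∫ x, ⟪U n t x, ψ t x⟫) - ∫ x, ⟪U n s x, ψ s x⟫ =
        ∫ τ in s..t, ∫ x, (⟪U n τ x, FluidPDE.timeDeriv ψ τ x⟫ +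
          ⟪U n τ x, FluidPDE.convect (mollify (φ n) (U n τ)) (ψ τ) x⟫ + ν * ⟪U n τ x, Δ (ψ τ) x⟫)
  /-- The dissipation `∫₀ᵀ ∫ |∇U n|²` (classical gradient, Frobenius norm) is finite on every
  `(0, T)` (OP 2018, (6.80): it is at most `‖u₀‖²/(2ν)`). -/
  dissipation_lt_top : ∀ n T,
    ∫⁻ t in Ioo 0 T, ∫⁻ x, ENNReal.ofReal (FluidPDE.frobeniusNormSq (fderiv ℝ (U n t) x)) < ∞
  /-- The **energy equality** of the regularised solutions on every `[s, t] ⊆ [0, ∞)`: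
  `½‖U n t‖² + ν ∫ₛᵗ ∫ |∇U n|² = ½‖U n s‖²` (Leray 1934, §26 with (3.4); OP 2018, (6.80);
  RRS 2016, (14.17)). -/
  energy_eq : ∀ n s t, 0 ≤ s → s ≤ t →
    VectorCalculus.kineticEnergy (U n t) +
        ν * (∫⁻ τ in Ioo s t, ∫⁻ x,
          ENNReal.ofReal (FluidPDE.frobeniusNormSq (fderiv ℝ (U n τ) x))).toReal =
      VectorCalculus.kineticEnergy (U n s)
  /-- **Separation of energy**, uniformly in `n` (Leray 1934, §27, (5.7); OP 2018, Lemma 6.34;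
  RRS 2016, Prop. 14.3): `∫_{‖x‖>R₂} ‖U n t‖² ≤ ∫_{‖x‖>R₁} ‖U n 0‖² + C̄(t)/(R₂ − R₁)` for
  `0 < R₁ < R₂`, `t ≥ 0`, with `C̄` independent of `n`, `R₁`, `R₂`. -/
  tail : ∃ C : ℝ → ℝ, ∀ n (R₁ R₂ t : ℝ), 0 < R₁ → R₁ < R₂ → 0 ≤ t →
    ∫⁻ x in {x | R₂ < ‖x‖}, ‖U n t x‖ₑ ^ 2 ≤
      (∫⁻ x in {x | R₁ < ‖x‖}, ‖U n 0 x‖ₑ ^ 2) + ENNReal.ofReal (C t / (R₂ - R₁))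
  /-- The datum of the `n`-th regularised problem is the mollified datum `J_{φ n} u₀`
  (Leray 1934, §28; OP 2018, (6.91); RRS 2016, (14.16)). -/
  initial : ∀ n, U n 0 = mollify (φ n) u₀

end Scheme

/-! ### The two halves of the proof on `ℝ³`, and the assembly -/

/-- Local notation for physical space `ℝ³ = EuclideanSpace ℝ (Fin 3)`. -/
local notation "ℝ³" => EuclideanSpace ℝ (Fin 3)

/-- **Existence of the Leray regularised scheme** (Leray 1934, Acta Math. 63, Ch. V, §26,
pp. 231–232: the unique regular solution of the regularised system (5.1) with a regular datum is
defined for all `t > 0` — the `L^∞` bound obeys a linear Volterra inequality because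
`‖\overline{u}‖_∞ ≤ A₀ ε^{-3/2} √W(t)` — and §27, pp. 232–235, (5.2)–(5.7): répartition de l'énergie
cinétique, indépendante de `ε`; Ożański–Pooley 2018, Thm. 6.33 (global well-posedness, smoothness,
energy equality (6.80)) and Lemma 6.34 (separation of energy, `C̄(u₀, t) = C‖u₀‖²√t + C‖u₀‖³t^{1/4}`
for `ν = 1`); Robinson–Rodrigo–Sadowski 2016, Thm. 14.1 (on `𝕋³`) and Prop. 14.3). Let `ν > 0` and let
`u₀ ∈ L²(ℝ³)` be weakly divergence free (hypotheses verbatim those of `leray_existence_R3`). Then for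
every sequence of mollifiers there is a Leray regularised scheme; in particular there are bump
kernels `φ n` with `rOut (φ n) → 0` and fields `U n` forming an `IsLerayRegularisedScheme ν u₀ φ U`:
`U n` is the global regular solution of the problem regularised at length `rOut (φ n)` with datum
`J_{φ n} u₀`, with its energy equality and the `n`-uniform tail estimate. The printed sources
normalise `ν = 1`; the rescaling `w(s, y) = ν⁻¹ u(s/ν, y)` (which does not touch the mollification
length) maps viscosity `ν` to viscosity `1` and preserves every clause, or one runs the same proof
with `ν`-dependent constants. [cite: Leray1934, Ch. V §§26–27, pp. 231–235, (5.1)–(5.7)] [cite: OzanskiPooley2018, Thm. 6.33, Lemma 6.34] [cite: RobinsonRodrigoSadowski2016, Thm. 14.1, Prop. 14.3] -/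
def leray_regularised_scheme_exists : Prop :=
  ∀ (ν : ℝ), 0 < ν → ∀ (u₀ : ℝ³ → ℝ³), MemLp u₀ 2 volume → FluidPDE.IsWeaklyDivFree u₀ →
    ∃ (φ : ℕ → ContDiffBump (0 : ℝ³)) (U : ℕ → ℝ → ℝ³ → ℝ³), IsLerayRegularisedScheme ν u₀ φ U

/-- **Passage to the limit in the Leray regularisation** (Leray 1934, Acta Math. 63, Ch. V,
§§28–31, pp. 235–241: weak limits of `u*` along a sequence `ε* → 0`, strong convergence en moyenne
at every time outside the null set where `lim inf J*(t) = +∞` (Lemma 2 and the tail estimate (5.7)),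
the relation (5.15) in the limit, and the definition/Théorème d'existence of §31; Ożański–Pooley 2018,
Thm. 6.37, Steps 1–4, with Def. 6.35 and Cor. 6.36 (weak `L²` continuity, `u(t) → u(s)` as `t → s⁺`
for `s ∉ S`, `‖u(t) − u₀‖ → 0`); Robinson–Rodrigo–Sadowski 2016, Thm. 14.4 (the strong energy
inequality (14.19) for `s = 0` and a.e. `s > 0`, all `t ≥ s`)). Let `ν > 0` and let `u₀ ∈ L²(ℝ³)` be
weakly divergence free. Every Leray regularised scheme `(φ, U)` for `(ν, u₀)` yields a global
Leray–Hopf weak solution: there is `u : ℝ → ℝ³ → ℝ³` with `Fluid.IsGlobalLerayHopf ν 0 u₀ u` (obtained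
along a subsequence with `U n t ⇀ u t` weakly in `L²` for every `t ≥ 0` and strongly for a.e. `t`).
[cite: Leray1934, Ch. V §§28–31, pp. 235–241, Théorème d'existence p. 241] [cite: OzanskiPooley2018, Thm. 6.37, Cor. 6.36] [cite: RobinsonRodrigoSadowski2016, Thm. 14.4] -/
def leray_regularised_limit : Prop :=
  ∀ (ν : ℝ), 0 < ν → ∀ (u₀ : ℝ³ → ℝ³), MemLp u₀ 2 volume → FluidPDE.IsWeaklyDivFree u₀ →
    ∀ (φ : ℕ → ContDiffBump (0 : ℝ³)) (U : ℕ → ℝ → ℝ³ → ℝ³), IsLerayRegularisedScheme ν u₀ φ U →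
      ∃ u : ℝ → ℝ³ → ℝ³, FluidPDE.IsGlobalLerayHopf ν 0 u₀ u

/-- **Assembly of Leray's existence theorem on `ℝ³`** from its two halves: the regularised
solutions exist with `ε`-uniform bounds (`leray_regularised_scheme_exists`; Leray 1934, §§26–27) and
every regularised scheme has a Leray–Hopf limit (`leray_regularised_limit`; Leray 1934, §§28–31).
Real proof (composition). [cite: Leray1934, Ch. V §§26–31] -/
theorem leray_existence_R3_of_regularised (h₁ : leray_regularised_scheme_exists)
    (h₂ : leray_regularised_limit) : leray_existence_R3 := by
  intro ν hν u₀ hu₀ hdiv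
  obtain ⟨φ, U, hS⟩ := h₁ ν hν u₀ hu₀ hdiv
  exact h₂ ν hν u₀ hu₀ hdiv φ U hS

/-! ### API of a regularised scheme: the data and the uniform `L²` bound (OP (6.88), (6.91), (6.92)) -/

section SchemeAPI

variable {E : Type*} [NormedAddCommGroup E] [InnerProductSpace ℝ E] [FiniteDimensional ℝ E]
  [MeasurableSpace E] [BorelSpace E]
variable {ν : ℝ} {u₀ : E → E} {φ : ℕ → ContDiffBump (0 : E)} {U : ℕ → ℝ → E → E}

/-- The mollification of an `L²` field is in `L²` (Young; OP 2018, Lemma 6.2 (i)). [cite: OzanskiPooley2018, Lemma 6.2 (i)] -/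
theorem memLp_mollify (ψ : ContDiffBump (0 : E)) {v : E → E} (hv : MemLp v 2 volume) :
    MemLp (mollify ψ v) 2 volume :=
  FunctionSpaces.memLp_normed_convolution ψ hv one_le_two

/-- Mollification does not increase the `L²` norm: `‖J_φ v‖₂ ≤ ‖v‖₂` (Young's inequality with a
unit-mass kernel; OP 2018, Lemma 6.2 (i), used as (6.92)). [cite: OzanskiPooley2018, Lemma 6.2 (i)] -/
theorem eLpNorm_mollify_le (ψ : ContDiffBump (0 : E)) {v : E → E}
    (hv : AEStronglyMeasurable v volume) :
    eLpNorm (mollify ψ v) 2 volume ≤ eLpNorm v 2 volume :=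
  FunctionSpaces.eLpNorm_normed_convolution_le ψ hv one_le_two

/-- The data of a regularised scheme are in `L²`: `U n 0 = J_{φ n} u₀ ∈ L²` (OP 2018, (6.88)). [cite: OzanskiPooley2018, (6.88)] -/
theorem IsLerayRegularisedScheme.memLp_initial (hS : IsLerayRegularisedScheme ν u₀ φ U)
    (hu₀ : MemLp u₀ 2 volume) (n : ℕ) : MemLp (U n 0) 2 volume := by
  rw [hS.initial n]
  exact memLp_mollify (φ n) hu₀

/-- `‖U n 0‖₂ = ‖J_{φ n} u₀‖₂ ≤ ‖u₀‖₂` (OP 2018, (6.88): "the last inequality is a property of the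
mollification operator"). [cite: OzanskiPooley2018, (6.88)] -/
theorem IsLerayRegularisedScheme.eLpNorm_initial_le (hS : IsLerayRegularisedScheme ν u₀ φ U)
    (hu₀ : MemLp u₀ 2 volume) (n : ℕ) : eLpNorm (U n 0) 2 volume ≤ eLpNorm u₀ 2 volume := by
  rw [hS.initial n]
  exact eLpNorm_mollify_le (φ n) hu₀.aestronglyMeasurable

/-- The data converge: `‖U n 0 − u₀‖₂ = ‖J_{φ n} u₀ − u₀‖₂ → 0` (OP 2018, (6.91), Lemma 6.2 (vi);
mollification converges in `L²`, `Literature.Analysis.FunctionSpaces.tendsto_eLpNorm_normed_convolution_sub_self`). [cite: OzanskiPooley2018, (6.91)] -/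
theorem IsLerayRegularisedScheme.tendsto_initial (hS : IsLerayRegularisedScheme ν u₀ φ U)
    (hu₀ : MemLp u₀ 2 volume) :
    Tendsto (fun n => eLpNorm (U n 0 - u₀) 2 volume) atTop (𝓝 0) := by
  have h := FunctionSpaces.tendsto_eLpNorm_normed_convolution_sub_self (μ := (volume : Measure E)) hS.tendsto_rOut
    one_le_two ENNReal.ofNat_ne_top hu₀
  refine h.congr' (Eventually.of_forall fun n => ?_)
  show _ = eLpNorm (U n 0 - u₀) 2 volume
  rw [hS.initial n]

/-- The slices `U n t`, `t > 0`, of a regularised scheme are `C¹` (compose the joint `C¹` map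
with `x ↦ (t, x)`). [folklore] -/
theorem IsLerayRegularisedScheme.contDiff_slice (hS : IsLerayRegularisedScheme ν u₀ φ U) (n : ℕ)
    {t : ℝ} (ht : 0 < t) : ContDiff ℝ 1 (U n t) := by
  have hc : ContDiff ℝ 1 (fun x : E => ((t, x) : ℝ × E)) := contDiff_const.prodMk contDiff_id
  have := (hS.contDiffOn n).comp_contDiff hc (fun x => mk_mem_prod ht (mem_univ x))
  simpa [Function.comp_def] using this

/-- For `t > 0` the classical gradient of the slice `U n t` is a weak gradient
(`Fluid.HasWeakGradient.of_contDiff_holds`; OP 2018, (6.102): "the limit function is `∇u(t)` by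
the definition of weak derivatives"). [folklore] -/
theorem IsLerayRegularisedScheme.hasWeakGradient_slice (hS : IsLerayRegularisedScheme ν u₀ φ U)
    (n : ℕ) {t : ℝ} (ht : 0 < t) : FluidPDE.HasWeakGradient (U n t) (fderiv ℝ (U n t)) :=
  HasWeakGradient.of_contDiff_holds (hS.contDiff_slice n ht)

/-- Divergence-free slices are weakly divergence free: `∫ ⟪U n t, ∇θ⟫ = 0` for `t > 0` and every
test function `θ` (`Fluid.IsDivFree.isWeaklyDivFree_holds`). [folklore] -/
theorem IsLerayRegularisedScheme.isWeaklyDivFree (hS : IsLerayRegularisedScheme ν u₀ φ U) (n : ℕ)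
    {t : ℝ} (ht : 0 < t) : FluidPDE.IsWeaklyDivFree (U n t) :=
  VectorCalculus.IsDivFree.isWeaklyDivFree_holds (hS.divFree n t ht) (hS.contDiff_slice n ht)

/-- **The space–time weak form** of the regularised equations, in the shape of the accepted
`Fluid.IsWeakNSSolutionOn` (tests compactly supported in `(-∞, T) × E`, time integral over
`(0, T)`, datum term at `t = 0`):
`∫₀ᵀ∫ (⟪U n, ∂ₜψ⟫ + ⟪U n, ((J_{φ n} U n)·∇)ψ⟫ + ν⟪U n, Δψ⟫) + ∫⟪U n 0, ψ 0⟫ = 0` — the case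
`s = 0`, `t = T` of the clause `regularised`, since `ψ T = 0` (OP 2018, (6.78)/(6.89); Leray 1934,
(5.15)). [cite: OzanskiPooley2018, (6.89)] -/
theorem IsLerayRegularisedScheme.spaceTime_identity (hS : IsLerayRegularisedScheme ν u₀ φ U)
    (n : ℕ) {T : ℝ} (hT : 0 < T) {ψ : ℝ → E → E}
    (hψ : FluidPDE.IsSpaceTimeTestOn (FluidPDE.slab E (Iio T) isOpen_Iio) ψ)
    (hdiv : ∀ τ, VectorCalculus.IsDivFree (ψ τ)) :
    (∫ t in Ioo 0 T, ∫ x, (⟪U n t x, FluidPDE.timeDeriv ψ t x⟫ +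
        ⟪U n t x, FluidPDE.convect (mollify (φ n) (U n t)) (ψ t) x⟫ + ν * ⟪U n t x, Δ (ψ t) x⟫)) +
      ∫ x, ⟪U n 0 x, ψ 0 x⟫ = 0 := by
  have h := hS.regularised n ψ (hψ.mono le_top) hdiv 0 T le_rfl hT.le
  have hT0 : ∀ x, ψ T x = 0 := fun x =>
    hψ.apply_eq_zero (by simp)
  simp only [hT0, inner_zero_right, integral_zero, zero_sub] at h
  rw [intervalIntegral.integral_of_le hT.le, integral_Ioc_eq_integral_Ioo] at h
  linarith

/-- **The regularised equations tested against a time-independent field** (OP 2018, (6.89) with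
`φ(x, t) = ψ(x)`, the form used for (6.96); Leray 1934, (5.15)): for a smooth compactly supported
divergence-free `a : E → E` and `0 ≤ s ≤ t`,
`⟪U n t, a⟫ − ⟪U n s, a⟫ = ∫ₛᵗ ∫ (⟪U n τ, ((J_{φ n} U n τ)·∇)a⟫ + ν ⟪U n τ, Δa⟫) dτ`.
Real proof from the clause `regularised` with the space–time test field `θ(τ) a(x)`, `θ` a bump in
time with plateau `θ ≡ 1` on a neighbourhood of `[s, t]` (so `∂ₜ(θ a) = 0` there). This is the
identity from which the equicontinuity of `t ↦ ⟪U n t, a⟫` and the weak `L²` limits are extracted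
in Step 1 of the proof of OP Thm. 6.37. [cite: OzanskiPooley2018, (6.89), (6.96)] -/
theorem IsLerayRegularisedScheme.slice_identity (hS : IsLerayRegularisedScheme ν u₀ φ U) (n : ℕ)
    {a : E → E} (ha : FunctionSpaces.IsTestFunctionOn (⊤ : Opens E) a) (hdiv : VectorCalculus.IsDivFree a) {s t : ℝ}
    (hs : 0 ≤ s) (hst : s ≤ t) :
    (∫ x, ⟪U n t x, a x⟫) - ∫ x, ⟪U n s x, a x⟫ =
      ∫ τ in s..t, ∫ x, (⟪U n τ x, FluidPDE.convect (mollify (φ n) (U n τ)) a x⟫ +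
        ν * ⟪U n τ x, Δ a x⟫) := by
  -- a temporal bump with plateau on `[s, t]`
  set c : ℝ := (s + t) / 2 with hc
  let θ : ContDiffBump c := ⟨(t - s) / 2 + 1, (t - s) / 2 + 2, by linarith, by linarith⟩
  have had : Differentiable ℝ a := ha.contDiff.differentiable (by simp)
  have ha2 : ContDiff ℝ 2 a := contDiff_infty.1 ha.contDiff 2
  have hθd : Differentiable ℝ θ := (θ.contDiff (n := 1)).differentiable one_ne_zero
  -- `θ = 1` near every point of `[s, t]`, hence `θ = 1` and `θ' = 0` on `[s, t]`
  have hrIn : θ.rIn = (t - s) / 2 + 1 := rfl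
  have hball : Icc s t ⊆ Metric.ball c θ.rIn := by
    intro τ hτ
    rw [Metric.mem_ball, Real.dist_eq, abs_lt, hrIn, hc]
    constructor <;> linarith [hτ.1, hτ.2]
  have hone : ∀ τ ∈ Icc s t, θ τ = 1 := fun τ hτ =>
    θ.one_of_mem_closedBall (Metric.ball_subset_closedBall (hball hτ))
  have hderiv : ∀ τ ∈ Icc s t, deriv θ τ = 0 := by
    intro τ hτ
    have hev : (θ : ℝ → ℝ) =ᶠ[𝓝 τ] fun _ => (1 : ℝ) := by
      filter_upwards [Metric.isOpen_ball.mem_nhds (hball hτ)] with σ hσ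
      exact θ.one_of_mem_closedBall (Metric.ball_subset_closedBall hσ)
    exact ((hasDerivAt_const τ (1 : ℝ)).congr_of_eventuallyEq hev).deriv
  -- the space–time test field `θ(τ) a(x)` on the slab `(-∞, T) × E`, `T` past the support of `θ`
  set T : ℝ := c + θ.rOut + 1 with hT
  have hθT : tsupport (θ : ℝ → ℝ) ⊆ Iio T := by
    rw [θ.tsupport_eq]
    intro τ hτ
    rw [Metric.mem_closedBall, Real.dist_eq] at hτ
    show τ < c + θ.rOut + 1
    linarith [le_abs_self (τ - c)]
  have hψ : FluidPDE.IsSpaceTimeTestOn (⊤ : Opens (ℝ × E)) (fun τ x => θ τ • a x) :=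
    (FluidPDE.isSpaceTimeTestOn_smul θ.contDiff θ.hasCompactSupport hθT ha).mono le_top
  have key := hS.regularised n (fun τ x => θ τ • a x) hψ
    (fun τ => FluidPDE.isDivFree_const_smul hdiv had (θ τ)) s t hs hst
  have hts : t ∈ Icc s t := ⟨hst, le_rfl⟩
  have hss : s ∈ Icc s t := ⟨le_rfl, hst⟩
  simp only [hone t hts, hone s hss, one_smul] at key
  rw [key]
  refine intervalIntegral.integral_congr fun τ hτ => ?_
  rw [uIcc_of_le hst] at hτ
  refine integral_congr_ae (Eventually.of_forall fun x => ?_)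
  simp only
  rw [FluidPDE.timeDeriv_smul hθd, FluidPDE.convect_const_smul _ had, FluidPDE.laplacian_const_smul ha2,
    hone τ hτ, hderiv τ hτ, one_smul, one_smul, zero_smul, inner_zero_right, zero_add]

/-- Every slice `U n t`, `t ≥ 0`, of a regularised scheme is in `L²` (projection of
`continuousInL2`). [folklore] -/
theorem IsLerayRegularisedScheme.memLp (hS : IsLerayRegularisedScheme ν u₀ φ U) (n : ℕ) {t : ℝ}
    (ht : 0 ≤ t) : MemLp (U n t) 2 volume :=
  (hS.continuousInL2 n).1 t ht

/-- For `L²` fields the kinetic energies compare like the `L²` norms: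
`‖v‖₂ ≤ ‖w‖₂ → ½∫‖v‖² ≤ ½∫‖w‖²` (through `eEnergy = ‖·‖₂² = ofReal (2 · kineticEnergy)`). [folklore] -/
theorem kineticEnergy_le_of_eLpNorm_le {v w : E → E}
    (hv : MemLp v 2 volume) (hw : MemLp w 2 volume)
    (h : eLpNorm v 2 volume ≤ eLpNorm w 2 volume) :
    VectorCalculus.kineticEnergy v ≤ VectorCalculus.kineticEnergy w := by
  have h2 : FluidPDE.eEnergy v ≤ FluidPDE.eEnergy w := by
    rw [FluidPDE.eEnergy_eq_eLpNorm_sq, FluidPDE.eEnergy_eq_eLpNorm_sq]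
    gcongr
  rw [FluidPDE.eEnergy_eq_ofReal v hv, FluidPDE.eEnergy_eq_ofReal w hw,
    ENNReal.ofReal_le_ofReal_iff (mul_nonneg zero_le_two (FluidPDE.kineticEnergy_nonneg w))] at h2
  linarith [FluidPDE.kineticEnergy_nonneg w]

/-- `½‖U n 0‖² ≤ ½‖u₀‖²` (OP 2018, (6.88)). [cite: OzanskiPooley2018, (6.88)] -/
theorem IsLerayRegularisedScheme.kineticEnergy_initial_le (hS : IsLerayRegularisedScheme ν u₀ φ U)
    (hu₀ : MemLp u₀ 2 volume) (n : ℕ) :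
    VectorCalculus.kineticEnergy (U n 0) ≤ VectorCalculus.kineticEnergy u₀ :=
  kineticEnergy_le_of_eLpNorm_le (hS.memLp_initial hu₀ n) hu₀ (hS.eLpNorm_initial_le hu₀ n)

/-- The energy is non-increasing along a regularised solution for `ν ≥ 0`:
`½‖U n t‖² ≤ ½‖U n s‖²` for `0 ≤ s ≤ t` (the dissipation in the energy equality is nonnegative;
OP 2018, (6.80)). [cite: OzanskiPooley2018, (6.80)] -/
theorem IsLerayRegularisedScheme.kineticEnergy_le (hS : IsLerayRegularisedScheme ν u₀ φ U)
    (hν : 0 ≤ ν) (n : ℕ) {s t : ℝ} (hs : 0 ≤ s) (hst : s ≤ t) :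
    VectorCalculus.kineticEnergy (U n t) ≤ VectorCalculus.kineticEnergy (U n s) := by
  have h := hS.energy_eq n s t hs hst
  have hd : 0 ≤ ν * (∫⁻ τ in Ioo s t, ∫⁻ x,
      ENNReal.ofReal (FluidPDE.frobeniusNormSq (fderiv ℝ (U n τ) x))).toReal :=
    mul_nonneg hν ENNReal.toReal_nonneg
  linarith

/-- **The uniform `L²` bound** of a regularised scheme (OP 2018, (6.88)/(6.92); RRS 2016, (14.18)):
`½‖U n t‖² ≤ ½‖u₀‖²` for every `n` and `t ≥ 0`, when `ν ≥ 0`. [cite: OzanskiPooley2018, (6.88)] -/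
theorem IsLerayRegularisedScheme.kineticEnergy_le_datum (hS : IsLerayRegularisedScheme ν u₀ φ U)
    (hν : 0 ≤ ν) (hu₀ : MemLp u₀ 2 volume) (n : ℕ) {t : ℝ} (ht : 0 ≤ t) :
    VectorCalculus.kineticEnergy (U n t) ≤ VectorCalculus.kineticEnergy u₀ :=
  (hS.kineticEnergy_le hν n le_rfl ht).trans (hS.kineticEnergy_initial_le hu₀ n)

/-- The uniform `L²` bound in extended form: `∫⁻ ‖U n t‖ₑ² ≤ ∫⁻ ‖u₀‖ₑ²` for `t ≥ 0`, `ν ≥ 0`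
(OP 2018, (6.88)). [cite: OzanskiPooley2018, (6.88)] -/
theorem IsLerayRegularisedScheme.eEnergy_le (hS : IsLerayRegularisedScheme ν u₀ φ U)
    (hν : 0 ≤ ν) (hu₀ : MemLp u₀ 2 volume) (n : ℕ) {t : ℝ} (ht : 0 ≤ t) :
    FluidPDE.eEnergy (U n t) ≤ FluidPDE.eEnergy u₀ := by
  rw [FluidPDE.eEnergy_eq_ofReal _ (hS.memLp n ht), FluidPDE.eEnergy_eq_ofReal _ hu₀]
  exact ENNReal.ofReal_le_ofReal (by linarith [hS.kineticEnergy_le_datum hν hu₀ n ht])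

/-- The uniform `L²` bound as a norm inequality: `‖U n t‖₂ ≤ ‖u₀‖₂` for `t ≥ 0`, `ν ≥ 0`
(OP 2018, (6.88)). [cite: OzanskiPooley2018, (6.88)] -/
theorem IsLerayRegularisedScheme.eLpNorm_le (hS : IsLerayRegularisedScheme ν u₀ φ U)
    (hν : 0 ≤ ν) (hu₀ : MemLp u₀ 2 volume) (n : ℕ) {t : ℝ} (ht : 0 ≤ t) :
    eLpNorm (U n t) 2 volume ≤ eLpNorm u₀ 2 volume := by
  have h := hS.eEnergy_le hν hu₀ n ht
  rw [FluidPDE.eEnergy_eq_eLpNorm_sq, FluidPDE.eEnergy_eq_eLpNorm_sq] at h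
  exact (ENNReal.pow_le_pow_left_iff two_ne_zero).1 h

/-- The mollified slices obey the same bound: `‖J_{φ n} (U n t)‖₂ ≤ ‖u₀‖₂` for `t ≥ 0`, `ν ≥ 0`
(OP 2018, (6.92)). [cite: OzanskiPooley2018, (6.92)] -/
theorem IsLerayRegularisedScheme.eLpNorm_mollify_slice_le (hS : IsLerayRegularisedScheme ν u₀ φ U)
    (hν : 0 ≤ ν) (hu₀ : MemLp u₀ 2 volume) (n : ℕ) {t : ℝ} (ht : 0 ≤ t) :
    eLpNorm (mollify (φ n) (U n t)) 2 volume ≤ eLpNorm u₀ 2 volume :=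
  (eLpNorm_mollify_le (φ n) (hS.memLp n ht).aestronglyMeasurable).trans (hS.eLpNorm_le hν hu₀ n ht)

/-- The total dissipation is bounded by the initial energy: `ν ∫₀ᵗ ∫ |∇U n|² ≤ ½‖u₀‖²` for
`t ≥ 0` (OP 2018, (6.88); the input of Fatou's lemma in Step 2 of the proof of Thm. 6.37). [cite: OzanskiPooley2018, (6.88)] -/
theorem IsLerayRegularisedScheme.dissipation_le (hS : IsLerayRegularisedScheme ν u₀ φ U)
    (hu₀ : MemLp u₀ 2 volume) (n : ℕ) {t : ℝ} (ht : 0 ≤ t) :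
    ν * (∫⁻ τ in Ioo 0 t, ∫⁻ x,
        ENNReal.ofReal (FluidPDE.frobeniusNormSq (fderiv ℝ (U n τ) x))).toReal ≤
      VectorCalculus.kineticEnergy u₀ := by
  have h := hS.energy_eq n 0 t le_rfl ht
  linarith [FluidPDE.kineticEnergy_nonneg (U n t), hS.kineticEnergy_initial_le hu₀ n]

end SchemeAPI

/-! ### RRS Cor. 4.7 on `E`: the energy inequality forces strong attainment of the datum

`E`-side twins of `NS.strong_initial_of_energy_ineq` / `NS.isLerayHopfOn_of_clauses`
(`FluidPDE/NSHopfGalerkin`, torus side): these real proofs discharge the `strong_initial` clause of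
`Fluid.IsLerayHopfOn` for any candidate limit of a regularised scheme (last step of the proof of
`leray_regularised_limit`; OP 2018, end of the proof of Thm. 6.37: "`‖u(t) − u₀‖ → 0` as `t → 0` since
`u(t) ⇀ u₀` in `L²` … and `‖u(t)‖ → ‖u₀‖` (a consequence of … the energy inequality with `s = 0`)"). -/

section StrongInitial

variable {E : Type*} [NormedAddCommGroup E] [InnerProductSpace ℝ E] [FiniteDimensional ℝ E]
  [MeasurableSpace E] [BorelSpace E]

/-- **Strong attainment of the datum from the energy inequality** on `E`
(Robinson–Rodrigo–Sadowski 2016, Cor. 4.7; Ożański–Pooley 2018, end of the proof of Thm. 6.37;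
Hopf 1951, §4). If every slice `u t`, `t ∈ [0, T]` (`T > 0`), is in `L²`, the energy inequality from
`s = 0` holds on `[0, T]` with viscosity `ν ≥ 0`, some dissipation density `G`, force `f` and datum
`u₀ ∈ L²` (the third conjunct of the clause `weakGrad_energy` of `Fluid.IsLerayHopfOn`), and
`u t ⇀ u₀` weakly as `t → 0⁺` tested against `u₀` (a consequence of the clause `weak_continuous`),
then `‖u t − u₀‖_{L²} → 0` as `t → 0⁺` (the clause `strong_initial`). Proof: `limsup ‖u(t)‖² ≤ ‖u₀‖²`
from the energy inequality (nonnegative dissipation, `∫₀ᵗ∫⟪f, u⟫ → 0` by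
`tendsto_intervalIntegral_right_zero`), then RRS Lemma A.20
(`tendsto_eLpNorm_sub_of_tendsto_inner_of_normSq_le`). [cite: RobinsonRodrigoSadowski2016, Cor. 4.7] -/
theorem fluid_strong_initial_of_energy_ineq {T ν : ℝ} (hT : 0 < T) (hν : 0 ≤ ν)
    {f u : ℝ → E → E} {u₀ : E → E} {G : ℝ → E → E →L[ℝ] E} (hu₀ : MemLp u₀ 2 volume)
    (hmem : ∀ t ∈ Icc 0 T, MemLp (u t) 2 volume)
    (hE : ∀ t ∈ Icc 0 T, VectorCalculus.kineticEnergy (u t) +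
        ν * (∫⁻ τ in Ioo 0 t, ∫⁻ x, ENNReal.ofReal (FluidPDE.frobeniusNormSq (G τ x))).toReal ≤
      VectorCalculus.kineticEnergy u₀ + ∫ τ in 0..t, ∫ x, ⟪f τ x, u τ x⟫)
    (hweak : Tendsto (fun t => ∫ x, ⟪u t x, u₀ x⟫) (𝓝[>] 0) (𝓝 (∫ x, ⟪u₀ x, u₀ x⟫))) :
    Tendsto (fun t => eLpNorm (u t - u₀) 2 volume) (𝓝[>] 0) (𝓝 0) := by
  classical
  -- replace `u` by a family all of whose slices are in `L²`, equal to `u` near `0⁺`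
  set v : ℝ → E → E := fun t => if t ∈ Icc 0 T then u t else u₀ with hv
  have hIoc : ∀ᶠ t in 𝓝[>] (0 : ℝ), t ∈ Ioc 0 T := Ioc_mem_nhdsGT hT
  have hvu : ∀ᶠ t in 𝓝[>] (0 : ℝ), v t = u t := by
    filter_upwards [hIoc] with t ht
    show (if t ∈ Icc 0 T then u t else u₀) = u t
    rw [if_pos (Ioc_subset_Icc_self ht)]
  have hvmem : ∀ t, MemLp (v t) 2 volume := fun t => by
    show MemLp (if t ∈ Icc 0 T then u t else u₀) 2 volume
    by_cases ht : t ∈ Icc 0 T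
    · rw [if_pos ht]; exact hmem t ht
    · rw [if_neg ht]; exact hu₀
  have hmain : Tendsto (fun t => eLpNorm (v t - u₀) 2 volume) (𝓝[>] 0) (𝓝 0) := by
    refine tendsto_eLpNorm_sub_of_tendsto_inner_of_normSq_le hvmem hu₀ ?_ ?_
    · refine hweak.congr' ?_
      filter_upwards [hvu] with t ht
      rw [ht]
    · intro ε hε
      have hforce : ∀ᶠ t in 𝓝[>] (0 : ℝ), ∫ τ in 0..t, ∫ x, ⟪f τ x, u τ x⟫ < ε / 2 :=
        (tendsto_intervalIntegral_right_zero (fun τ => ∫ x, ⟪f τ x, u τ x⟫) 0).eventually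
          (gt_mem_nhds (by positivity))
      filter_upwards [hIoc, hvu, hforce] with t ht htv hft
      rw [htv]
      have hEt := hE t (Ioc_subset_Icc_self ht)
      have hdiss : 0 ≤ ν * (∫⁻ τ in Ioo 0 t, ∫⁻ x,
          ENNReal.ofReal (FluidPDE.frobeniusNormSq (G τ x))).toReal :=
        mul_nonneg hν ENNReal.toReal_nonneg
      simp only [VectorCalculus.kineticEnergy] at hEt
      linarith
  exact hmain.congr' (by filter_upwards [hvu] with t ht; rw [ht])

/-- **Leray–Hopf from the other clauses** on `E × [0, T)`, `T > 0`, `ν ≥ 0`, datum `u₀ ∈ L²`: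
a weak solution with the `L^∞_t L²_x` bound, `L²` slices, the `weakGrad_energy` clause (weak
gradient in `L²_t L²_x` with the energy inequalities from `0` and from a.e. `s`) and weak `L²`
continuity with weak limit `u₀` at `0⁺` is a Leray–Hopf weak solution — the remaining clause
`strong_initial` follows from `fluid_strong_initial_of_energy_ineq` (Robinson–Rodrigo–Sadowski
2016, Cor. 4.7). This is the form in which the limit of a Leray regularised scheme is shown to be
Leray–Hopf. [cite: RobinsonRodrigoSadowski2016, Cor. 4.7] -/
theorem fluid_isLerayHopfOn_of_clauses {T ν : ℝ} (hT : 0 < T) (hν : 0 ≤ ν)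
    {f u : ℝ → E → E} {u₀ : E → E} (hu₀ : MemLp u₀ 2 volume)
    (h₁ : FluidPDE.IsWeakNSSolutionOn T ν f u₀ u)
    (h₂ : ∃ C : ℝ≥0, ∀ᵐ t ∂(volume.restrict (Ioo 0 T)), FluidPDE.eEnergy (u t) ≤ C)
    (h₃ : ∀ t ∈ Icc 0 T, MemLp (u t) 2 volume)
    (h₄ : ∃ G : ℝ → E → E →L[ℝ] E,
      (∀ᵐ t ∂(volume.restrict (Ioo 0 T)), FluidPDE.HasWeakGradient (u t) (G t)) ∧
      (∫⁻ t in Ioo 0 T, ∫⁻ x, ENNReal.ofReal (FluidPDE.frobeniusNormSq (G t x)) < ∞) ∧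
      (∀ t ∈ Icc 0 T, VectorCalculus.kineticEnergy (u t) +
          ν * (∫⁻ τ in Ioo 0 t, ∫⁻ x, ENNReal.ofReal (FluidPDE.frobeniusNormSq (G τ x))).toReal ≤
        VectorCalculus.kineticEnergy u₀ + ∫ τ in 0..t, ∫ x, ⟪f τ x, u τ x⟫) ∧
      (∀ᵐ s ∂(volume.restrict (Ioo 0 T)), ∀ t ∈ Icc s T, VectorCalculus.kineticEnergy (u t) +
          ν * (∫⁻ τ in Ioo s t, ∫⁻ x, ENNReal.ofReal (FluidPDE.frobeniusNormSq (G τ x))).toReal ≤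
        VectorCalculus.kineticEnergy (u s) + ∫ τ in s..t, ∫ x, ⟪f τ x, u τ x⟫))
    (h₅ : ∀ w : E → E, MemLp w 2 volume →
      ContinuousOn (fun t => ∫ x, ⟪u t x, w x⟫) (Ioc 0 T) ∧
        Tendsto (fun t => ∫ x, ⟪u t x, w x⟫) (𝓝[>] 0) (𝓝 (∫ x, ⟪u₀ x, w x⟫))) :
    FluidPDE.IsLerayHopfOn T ν f u₀ u := by
  obtain ⟨G, hG, hint, h0, hae⟩ := h₄
  exact ⟨h₁, h₂, h₃, ⟨G, hG, hint, h0, hae⟩, h₅,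
    fluid_strong_initial_of_energy_ineq hT hν hu₀ h₃ h0 (h₅ u₀ hu₀).2⟩

end StrongInitial

end Literature.Analysis.FluidPDE
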